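import Mathlib
import Literature.Analysis.PDE.Wave1DExteriorEnergy
import HarnessLib

/-!
# Non-radiating functions: exterior energy `→ 0` from a pointwise `z⁻²` bound

Analysis/PDE support file (everything proved). If `φ` is `C²`, `W ≥ 0` continuous, and the energy
density `e(t,z) = φ_t² + φ_z² + W φ²` satisfies `e(t,z) ≤ C z⁻²` on the exterior region
`{z > 1 + |t|}`, then `e(t,·)` is integrable there, `∫_{z>1+|t|} e(t,z) dz ≤ C/(1+|t|)`, and the
exterior energy tends to `0` as `t → ±∞` (`wave1D_farEnergy_tendsto_zero`). This is how the
`t`-polynomial kernel elements `Σ tⁱ a_i(z)` (`|a_i| ≲ z^{γ₀−i}`, `γ₀ ≤ 0`) of the far-side channel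
estimate are seen to carry no channel energy (route PhotonSphereChannels, `FixedModeChannels`,
stmt-FinalStateConjecture-10048; Kenig–Lawrie–Liu–Schlag 2015, §1). Folklore.
-/

noncomputable section

namespace Literature.Analysis.PDE

open MeasureTheory Set Filter Topology Real

variable {W : ℝ → ℝ} {φ : ℝ → ℝ → ℝ}

/-- **Exterior energy of a non-radiating function.** See the module docstring. [folklore] -/
theorem wave1D_farEnergy_tendsto_zero (hW : Continuous W) (hW0 : ∀ z, 0 ≤ W z)
    (hφ : ContDiff ℝ 2 (Function.uncurry φ)) {C : ℝ}
    (hbd : ∀ t z, 1 + |t| < z →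
      deriv (fun τ => φ τ z) t ^ 2 + deriv (φ t) z ^ 2 + W z * φ t z ^ 2 ≤ C * z ^ (-(2 : ℝ))) :
    (∀ t, IntegrableOn (fun z => deriv (fun τ => φ τ z) t ^ 2 + deriv (φ t) z ^ 2 + W z * φ t z ^ 2)
        (Ioi (1 + |t|))) ∧
    (∀ t, (∫ z in Ioi (1 + |t|),
        (deriv (fun τ => φ τ z) t ^ 2 + deriv (φ t) z ^ 2 + W z * φ t z ^ 2)) ≤ C / (1 + |t|)) ∧
    Tendsto (fun t => ∫ z in Ioi (1 + |t|),
        (deriv (fun τ => φ τ z) t ^ 2 + deriv (φ t) z ^ 2 + W z * φ t z ^ 2)) atTop (𝓝 0) ∧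
    Tendsto (fun t => ∫ z in Ioi (1 + |t|),
        (deriv (fun τ => φ τ z) t ^ 2 + deriv (φ t) z ^ 2 + W z * φ t z ^ 2)) atBot (𝓝 0) := by
  have hcont : ∀ t, Continuous fun z =>
      deriv (fun τ => φ τ z) t ^ 2 + deriv (φ t) z ^ 2 + W z * φ t z ^ 2 := fun t =>
    (continuous_wave1D_energyDensity hW hφ).comp (continuous_const.prodMk continuous_id)
  have hnn : ∀ t z, 0 ≤ deriv (fun τ => φ τ z) t ^ 2 + deriv (φ t) z ^ 2 + W z * φ t z ^ 2 :=
    fun t z => wave1D_energyDensity_nonneg hW0 t z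
  have hedge : ∀ t : ℝ, (0 : ℝ) < 1 + |t| := fun t => by positivity
  have hmaj : ∀ t : ℝ, IntegrableOn (fun z : ℝ => C * z ^ (-(2 : ℝ))) (Ioi (1 + |t|)) := fun t =>
    (integrableOn_Ioi_rpow_of_lt (by norm_num) (hedge t)).const_mul C
  have hint : ∀ t, IntegrableOn (fun z => deriv (fun τ => φ τ z) t ^ 2 + deriv (φ t) z ^ 2
      + W z * φ t z ^ 2) (Ioi (1 + |t|)) := fun t =>
    Integrable.mono' (hmaj t) (hcont t).aestronglyMeasurable
      ((ae_restrict_iff' measurableSet_Ioi).2 (ae_of_all _ fun z hz => by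
        rw [Real.norm_eq_abs, abs_of_nonneg (hnn t z)]; exact hbd t z hz))
  have hle : ∀ t, (∫ z in Ioi (1 + |t|), (deriv (fun τ => φ τ z) t ^ 2 + deriv (φ t) z ^ 2
      + W z * φ t z ^ 2)) ≤ C / (1 + |t|) := by
    intro t
    calc (∫ z in Ioi (1 + |t|), (deriv (fun τ => φ τ z) t ^ 2 + deriv (φ t) z ^ 2
          + W z * φ t z ^ 2))
        ≤ ∫ z in Ioi (1 + |t|), C * z ^ (-(2 : ℝ)) :=
          setIntegral_mono_on (hint t) (hmaj t) measurableSet_Ioi fun z hz => hbd t z hz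
      _ = C * (-(1 + |t|) ^ (-(2 : ℝ) + 1) / (-(2 : ℝ) + 1)) := by
          rw [MeasureTheory.integral_const_mul, integral_Ioi_rpow_of_lt (by norm_num) (hedge t)]
      _ = C / (1 + |t|) := by
          rw [show -(2 : ℝ) + 1 = -1 by norm_num, rpow_neg_one]
          field_simp
  have hnn' : ∀ t, 0 ≤ ∫ z in Ioi (1 + |t|), (deriv (fun τ => φ τ z) t ^ 2 + deriv (φ t) z ^ 2
      + W z * φ t z ^ 2) := fun t => setIntegral_nonneg measurableSet_Ioi fun z _ => hnn t z
  -- `C/(1+|t|) → 0` in both directions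
  have habs : ∀ {l : Filter ℝ}, Tendsto (fun t : ℝ => |t|) l atTop →
      Tendsto (fun t => C / (1 + |t|)) l (𝓝 0) := fun h =>
    tendsto_const_nhds.div_atTop (tendsto_atTop_add_const_left _ _ h)
  have hsq : ∀ {l : Filter ℝ}, Tendsto (fun t : ℝ => |t|) l atTop →
      Tendsto (fun t => ∫ z in Ioi (1 + |t|), (deriv (fun τ => φ τ z) t ^ 2 + deriv (φ t) z ^ 2
        + W z * φ t z ^ 2)) l (𝓝 0) := fun h =>
    squeeze_zero (fun t => hnn' t) (fun t => hle t) (habs h)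
  exact ⟨hint, hle, hsq tendsto_abs_atTop_atTop, hsq tendsto_abs_atBot_atTop⟩

end Literature.Analysis.PDE
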